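import Summits.QuantumAdvantage.QuantumAdvantage.Theses.SpinorFlattening
import Literature.Computability.QuantumComplexity.GaussianRank

/-!
# Negative lemmas for the crux `SpinorFlattening.GaussRankTwoCopies` (stmt-QuantumAdvantage-1248)

Refuter-side (cdisprove) lemmas that do NOT assert the crux: they bound what any proof or
refutation of `χ_G(M ⊗ M) ≥ 4` can look like. The file declares theorems only (the four bit
strings, `|+⟩`, `|++⟩` and the Bell vector are written as explicit lambdas).

* `gaussRankTwoCopies_tight_four` — TIGHTNESS: four Gaussian terms DO reach `|M⟩^{⊗2}`
  (`|M⟩^{⊗2} = ½ Σ_{c,d ∈ {0,1}} |c c c c d d d d⟩`, computational basis states are Gaussian), i.e.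
  `χ_G(M ⊗ M) ≤ 4`; the `3` of the crux cannot be raised to `4`.
* `gaussRankTwoCopies_false_without_gaussianity` — LOAD-BEARING: with the dictionary predicate
  dropped (all nonzero vectors allowed) the statement fails with a single term.
* `gaussRankTwoCopies_false_without_linearIndependence` — LOAD-BEARING: if the `8` annihilating
  Majorana combinations are not required to be linearly independent (`A = 0` is allowed), every
  nonzero vector is in the dictionary and the statement fails with a single term.
* `Parity.gaussianRank_not_multiplicative` — the natural strengthening "χ_G is multiplicative
  under ⊗" is FALSE: `|+⟩` is not Gaussian, yet `|++⟩ = (|00⟩+|11⟩) + c_{0,X}(|00⟩+|11⟩)` is a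
  sum of two Gaussian vectors; so the crux genuinely needs the parity of `M`.

[folklore] (Cudby–Strelchuk 2023, §6: `χ_G(|M⟩^{⊗k}) ≤ 2^k`.)
-/

noncomputable section

set_option linter.dupNamespace false

namespace Summit.QuantumAdvantage.QuantumAdvantage.Theorems.GaussRankTwoCopies.Negative

open Literature.Computability.Cryptography Literature.Computability.QuantumComplexity Matrix

/-- `|M⟩^{⊗2}` is a nonzero vector (amplitude `1/2` at the all-`false` string). [folklore] -/
theorem magicMPow_two_ne_zero : magicMPow 2 ≠ 0 := by
  intro h
  have h0 := congrFun h (fun _ => false)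
  rw [magicMPow_apply, if_pos (fun k i => rfl), Pi.zero_apply] at h0
  have h2 : (Real.sqrt 2 : ℂ) ≠ 0 :=
    Complex.ofReal_ne_zero.mpr (Real.sqrt_ne_zero'.mpr (by norm_num))
  exact pow_ne_zero _ (inv_ne_zero h2) h0

/-- Counting form of the block-constancy test on an explicit vector of eight bits: the string is
block-constant iff it equals exactly one of the four block-constant strings `c⁴d⁴` (indexed by
`i : Fin 4` as `c = i % 2`, `d = i / 2`). [folklore] -/
theorem card_filter_blockConst_vec (b₀ b₁ b₂ b₃ b₄ b₅ b₆ b₇ : Bool) :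
    (Finset.univ.filter (fun i : Fin 4 =>
        (fun w : Fin (2 * 4) => ![b₀, b₁, b₂, b₃, b₄, b₅, b₆, b₇] w) =
          fun w : Fin (2 * 4) => if w.val < 4 then decide (i.val % 2 = 1) else decide (i.val / 2 = 1))).card =
      if (∀ k : Fin 2, ∀ i : Fin 4, (fun w : Fin (2 * 4) => ![b₀, b₁, b₂, b₃, b₄, b₅, b₆, b₇] w)
          (finProdFinEquiv (k, i)) =
        (fun w : Fin (2 * 4) => ![b₀, b₁, b₂, b₃, b₄, b₅, b₆, b₇] w) (finProdFinEquiv (k, (0 : Fin 4))))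
      then 1 else 0 := by
  revert b₀ b₁ b₂ b₃ b₄ b₅ b₆ b₇
  decide

/-- A string on `2 * 4` wires is block-constant iff it is one of the four strings `c⁴d⁴`, and then
exactly one. [folklore] -/
theorem card_filter_blockConst (x : QReg (2 * 4)) :
    (Finset.univ.filter (fun i : Fin 4 =>
        x = fun w : Fin (2 * 4) => if w.val < 4 then decide (i.val % 2 = 1) else decide (i.val / 2 = 1))).card =
      if (∀ k : Fin 2, ∀ i : Fin 4, x (finProdFinEquiv (k, i)) = x (finProdFinEquiv (k, (0 : Fin 4))))
      then 1 else 0 := by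
  have hx : x = fun w : Fin (2 * 4) => ![x 0, x 1, x 2, x 3, x 4, x 5, x 6, x 7] w := by
    funext w
    fin_cases w <;> rfl
  rw [hx]
  exact card_filter_blockConst_vec _ _ _ _ _ _ _ _

/-- **Tightness of the crux at four terms** (`χ_G(M ⊗ M) ≤ 4`): `|M⟩^{⊗2}` IS a linear
combination of four Gaussian states, namely `½ Σ_{c,d} |c⁴d⁴⟩` (computational basis states are
Gaussian, `basisState_isGaussian`). Hence the constant `3` in `GaussRankTwoCopies` cannot be
replaced by `4`. [cite: CudbyStrelchuk2023, §6 (χ_G(|M⟩^{⊗k}) ≤ 2^k)] -/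
theorem gaussRankTwoCopies_tight_four :
    ∃ (a : Fin 4 → ℂ) (g : Fin 4 → QReg (2 * 4) → ℂ),
      (∀ i, IsGaussian (g i)) ∧ magicMPow 2 = ∑ i, a i • g i := by
  refine ⟨fun _ => ((Real.sqrt 2 : ℂ)⁻¹) ^ 2, fun i => basisState
    (fun w : Fin (2 * 4) => if w.val < 4 then decide (i.val % 2 = 1) else decide (i.val / 2 = 1)),
    fun i => basisState_isGaussian _, ?_⟩
  funext x
  have hc := card_filter_blockConst x
  simp only [Finset.sum_apply, Pi.smul_apply, basisState_apply, smul_eq_mul, mul_ite, mul_one,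
    mul_zero]
  rw [Finset.sum_ite, Finset.sum_const_zero, add_zero, Finset.sum_const, nsmul_eq_mul]
  rw [magicMPow]
  split_ifs with hbc
  · rw [if_pos hbc] at hc
    simp [hc]
  · rw [if_neg hbc] at hc
    simp [hc]

/-- **Load-bearing: Gaussianity of the terms.** If the dictionary predicate is dropped (any
nonzero vector allowed), `|M⟩^{⊗2}` is one term. Any proof of the crux must use the Gaussian
structure of every term. [folklore] -/
theorem gaussRankTwoCopies_false_without_gaussianity :
    ¬ ∀ (a : Fin 1 → ℂ) (g : Fin 1 → QReg (2 * 4) → ℂ), (∀ i, g i ≠ 0) →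
        magicMPow 2 ≠ ∑ i, a i • g i := by
  intro h
  refine h (fun _ => 1) (fun _ => magicMPow 2) (fun _ => magicMPow_two_ne_zero) ?_
  simp

/-- **Load-bearing: linear independence of the annihilators.** If the `8` annihilating Majorana
combinations in the dictionary are not required to be linearly independent, `A = 0` qualifies every
nonzero vector and `|M⟩^{⊗2}` is one term. [folklore] -/
theorem gaussRankTwoCopies_false_without_linearIndependence :
    ¬ ∀ (a : Fin 1 → ℂ) (g : Fin 1 → QReg (2 * 4) → ℂ),
        (∀ i, g i ≠ 0 ∧ ∃ A : Fin (2 * 4) → (Fin (2 * 4) × Bool → ℂ),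
          ∀ k, (∑ p : Fin (2 * 4) × Bool, A k p • majorana (2 * 4) p.1 p.2) *ᵥ g i = 0) →
        magicMPow 2 ≠ ∑ i, a i • g i := by
  intro h
  refine h (fun _ => 1) (fun _ => magicMPow 2)
    (fun _ => ⟨magicMPow_two_ne_zero, fun _ _ => 0, ?_⟩) ?_
  · intro k
    simp
  · simp

/-! ### Parity is load-bearing: Gaussian rank is not multiplicative for mixed-parity vectors -/

namespace Parity

/-- Sum over one-wire labels = sum over the value of the single wire. [folklore] -/
theorem sum_qreg_one (f : QReg 1 → ℂ) :
    ∑ x : QReg 1, f x = f (fun _ => false) + f (fun _ => true) := by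
  rw [← Fintype.sum_equiv (Equiv.funUnique (Fin 1) Bool).symm
    (fun b => f ((Equiv.funUnique (Fin 1) Bool).symm b)) f (fun _ => rfl)]
  rw [Fintype.sum_bool, add_comm]
  congr 1

/-- Entries of the two Majoranas on one wire: no Jordan–Wigner string. [folklore] -/
theorem majorana_one_apply (b : Bool) (y x : QReg 1) :
    majorana 1 0 b y x = (if b then Pauli.Y else Pauli.X).mat (y 0) (x 0) := by
  rw [majorana_apply]
  have : (Finset.univ : Finset (Fin 1)).erase 0 = ∅ := by decide
  rw [this, Finset.prod_empty, mul_one]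

/-- `|+⟩ = |0⟩ + |1⟩` (one wire, unnormalised) is NOT Gaussian: a combination `α c_X + β c_Y`
kills it only if `α - iβ = 0 = α + iβ`, i.e. `α = β = 0`. So `χ_G(|+⟩) = 2`. [folklore] -/
theorem plus_not_isGaussian : ¬ IsGaussian (fun _ : QReg 1 => (1 : ℂ)) := by
  rintro ⟨-, A, hA, hann⟩
  have h0 := hann 0
  have hsum : (∑ p : Fin 1 × Bool, A 0 p • majorana 1 p.1 p.2) =
      A 0 (0, false) • majorana 1 0 false + A 0 (0, true) • majorana 1 0 true := by
    rw [Fintype.sum_prod_type, Fin.sum_univ_one, Fintype.sum_bool, add_comm]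
  rw [hsum] at h0
  have e1 : A 0 (0, false) - A 0 (0, true) * Complex.I = 0 := by
    have := congrFun h0 (fun _ => false)
    simp [Matrix.mulVec, dotProduct, sum_qreg_one, majorana_one_apply] at this
    linear_combination this
  have e2 : A 0 (0, false) + A 0 (0, true) * Complex.I = 0 := by
    have := congrFun h0 (fun _ => true)
    simp [Matrix.mulVec, dotProduct, sum_qreg_one, majorana_one_apply] at this
    linear_combination this
  have hα : A 0 (0, false) = 0 := by linear_combination (e1 + e2) / 2
  have hβ : A 0 (0, true) = 0 := by
    have : A 0 (0, true) * Complex.I = 0 := by linear_combination (e2 - e1) / 2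
    simpa [Complex.I_ne_zero] using this
  have hz : A 0 = 0 := by
    funext p
    obtain ⟨j, b⟩ := p
    have hj : j = 0 := Subsingleton.elim _ _
    subst hj
    cases b
    · simpa using hα
    · simpa using hβ
  exact (LinearIndependent.ne_zero 0 hA) hz

/-- Sum over two-wire labels. [folklore] -/
theorem sum_qreg_two (f : QReg 2 → ℂ) :
    ∑ x : QReg 2, f x = f ![false, false] + f ![false, true] + f ![true, false] + f ![true, true] := by
  rw [← Fintype.sum_equiv (piFinTwoEquiv fun _ => Bool).symm
    (fun p => f ![p.1, p.2]) f (fun p => by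
      show f ![p.1, p.2] = f ((piFinTwoEquiv fun _ => Bool).symm p)
      congr 1)]
  rw [Fintype.sum_prod_type]
  simp only [Fintype.sum_bool]
  ring

/-- Entries of the wire-0 Majoranas on two wires: `(X|Y)_{y₀x₀} · [y₁ = x₁]`. [folklore] -/
theorem majorana_two_zero_apply (b : Bool) (y x : QReg 2) :
    majorana 2 0 b y x = (if b then Pauli.Y else Pauli.X).mat (y 0) (x 0) * (Pauli.I).mat (y 1) (x 1) := by
  rw [majorana_apply]
  have : (Finset.univ : Finset (Fin 2)).erase 0 = {1} := by decide
  rw [this, Finset.prod_singleton]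
  have h10 : ¬ ((1 : Fin 2) < 0) := by decide
  rw [if_neg h10]

/-- Entries of the wire-1 Majoranas on two wires: `(X|Y)_{y₁x₁} · Z_{y₀x₀}` (Jordan–Wigner
string). [folklore] -/
theorem majorana_two_one_apply (b : Bool) (y x : QReg 2) :
    majorana 2 1 b y x = (if b then Pauli.Y else Pauli.X).mat (y 1) (x 1) * (Pauli.Z).mat (y 0) (x 0) := by
  rw [majorana_apply]
  have : (Finset.univ : Finset (Fin 2)).erase 1 = {0} := by decide
  rw [this, Finset.prod_singleton]
  have h01 : ((0 : Fin 2) < 1) := by decide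
  rw [if_pos h01]

/-- The even Bell vector `|00⟩ + |11⟩` is Gaussian: it is annihilated by
`c_{0X} + i c_{0Y} - c_{1X} + i c_{1Y}` (`= 2(a₀ - a₁†)`) and by `c_{0X} - i c_{0Y} + c_{1X} + i c_{1Y}`
(`= 2(a₁ + a₀†)`). [folklore] -/
theorem bell_isGaussian : IsGaussian (fun x : QReg 2 => if x 0 = x 1 then (1 : ℂ) else 0) := by
  refine ⟨fun h => by simpa using congrFun h ![false, false], ?_⟩
  refine ⟨fun k p => if k = 0 then (if p = (0, false) then 1 else if p = (0, true) then Complex.I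
      else if p = (1, false) then -1 else Complex.I)
    else (if p = (0, false) then 1 else if p = (0, true) then -Complex.I
      else if p = (1, false) then 1 else Complex.I), ?_, ?_⟩
  · rw [Fintype.linearIndependent_iff]
    intro g hg k
    have h1 := congrFun hg (0, false)
    have h2 := congrFun hg (0, true)
    simp [Fin.sum_univ_two] at h1 h2
    have hg0 : g 0 = 0 := by
      have : g 0 * (2 * Complex.I) = 0 := by linear_combination Complex.I * h1 + h2
      simpa [Complex.I_ne_zero] using this
    have hg1 : g 1 = 0 := by linear_combination h1 - hg0
    fin_cases k
    · exact hg0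
    · exact hg1
  · intro k
    funext y
    have hy : y = ![y 0, y 1] := by
      funext i
      fin_cases i <;> rfl
    rw [hy]
    generalize y 0 = a
    generalize y 1 = b
    rw [Fintype.sum_prod_type, Fin.sum_univ_two, Fintype.sum_bool, Fintype.sum_bool]
    simp only [Matrix.mulVec, dotProduct, Matrix.add_apply, Matrix.smul_apply, smul_eq_mul,
      sum_qreg_two, majorana_two_zero_apply, majorana_two_one_apply, Pi.zero_apply]
    fin_cases k <;> cases a <;> cases b <;> simp

/-- `|++⟩ = (|00⟩ + |11⟩) + c_{0X}(|00⟩ + |11⟩)`. [folklore] -/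
theorem plusplus_eq :
    (fun _ : QReg 2 => (1 : ℂ)) = (fun x : QReg 2 => if x 0 = x 1 then (1 : ℂ) else 0) +
      majorana 2 0 false *ᵥ (fun x : QReg 2 => if x 0 = x 1 then (1 : ℂ) else 0) := by
  funext y
  have hy : y = ![y 0, y 1] := by
    funext i
    fin_cases i <;> rfl
  rw [hy]
  simp only [Pi.add_apply, Matrix.mulVec, dotProduct, sum_qreg_two, majorana_two_zero_apply]
  cases y 0 <;> cases y 1 <;> simp

/-- **Gaussian rank is not multiplicative (mixed parity):** `|+⟩` is not Gaussian
(`χ_G(|+⟩) = 2`), but `|+⟩ ⊗ |+⟩ = |++⟩` is a sum of two Gaussian vectors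
(`IsGaussian.majorana_mulVec`), so `χ_G(|+⟩^{⊗2}) ≤ 2 < 4 = χ_G(|+⟩)²`. The crux for `M`
therefore needs the PARITY of `M` (its two Fock components have equal parity). [folklore] -/
theorem gaussianRank_not_multiplicative :
    ¬ IsGaussian (fun _ : QReg 1 => (1 : ℂ)) ∧
      ∃ g₁ g₂ : QReg 2 → ℂ, IsGaussian g₁ ∧ IsGaussian g₂ ∧ (fun _ : QReg 2 => (1 : ℂ)) = g₁ + g₂ :=
  ⟨plus_not_isGaussian, _, _, bell_isGaussian, bell_isGaussian.majorana_mulVec 0 false, plusplus_eq⟩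

end Parity

end Summit.QuantumAdvantage.QuantumAdvantage.Theorems.GaussRankTwoCopies.Negative
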